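import Mathlib.Analysis.Convex.Topology
import Literature.Probability.RandomPlanarGeometry.JordanDomainInterior
import Literature.Probability.RandomPlanarGeometry.JordanBoundaryLemmas
import HarnessLib

/-!
# Local structure of a Jordan domain with rectilinear boundary

Topic `Literature/Probability/RandomPlanarGeometry` (plane topology of Jordan domains, continuing
`PlanarDomainsTopology.lean` / `JordanDomainInterior.lean`; geometric input of the discharge of
`Literature.Probability.LatticeModels.Kenyon2000_flatEdgePoissonKernelLimit`, whose domains are
"rectilinear polyominoes": Jordan domains whose frontier lies in a finite union of axis-parallel
segments).

For a Jordan domain `D` with exterior `E = (closure D)ᶜ` (open, with `frontier D ⊆ closure E` by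
the Jordan curve theorem, `frontier_subset_closure_exterior`) we prove, with elementary
connectedness arguments only:

* `subset_or_subset_exterior_of_convex` — a convex open set missing `frontier D` lies in `D` or in
  `E`;
* `exists_pos_frontier_near_subset_cross` — if `frontier D` is covered by finitely many
  axis-parallel segments, then near each `ζ ∈ frontier D` the frontier lies on the cross
  `{re = re ζ} ∪ {im = im ζ}`;
* `exists_quadrant_subset_exterior` / `exists_quadrant_subset_exterior_of_near` — hence one of
  the four open quadrants of the disc `B(ζ, r)` lies in the exterior, and the same holds, with
  radius `r/2`, at every frontier point of `B(ζ, r/2)`;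
* **`exists_uniform_exterior_quadrant`** — by compactness there is one radius `r > 0` such that
  at every frontier point some open axis-parallel quadrant of radius `r` lies in the exterior (the
  "exterior cone condition" feeding the weak Beurling estimate on the lattice);
* **`halfDisc_structure_of_flat`** (and its `im`/`re` specialisations) — if near `x ∈ frontier D`
  the frontier lies on the line `ℓ = ℓ x` (`ℓ = re` or `im`), then in the disc `B(x, r)` the
  closure of `D` is exactly one of the two closed half-discs and `D` the corresponding open
  half-disc (the flat boundary edge of Kenyon's Corollary 19).

Everything is proved, [folklore]; no named fact.

## References

* R. Kenyon, *Conformal invariance of domino tiling*, Ann. Probab. 28 (2000), §1 and §5.3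
  (polyominoes, flat edges) [Kenyon2000].
* W. Werner, *Lectures on two-dimensional critical percolation* (2007), §2 [Werner2007].
-/

noncomputable section

namespace Literature.Probability.RandomPlanarGeometry.JordanDomain

open Set Metric Complex Filter _root_.Topology

variable (D : JordanDomain)

/-! ### Convex sets missing the frontier; points off a cross -/

/-- A convex open set that misses the boundary curve of a Jordan domain lies inside the domain or
in its exterior `(closure D)ᶜ`. [folklore] -/
theorem subset_or_subset_exterior_of_convex {C : Set ℂ} (hC : Convex ℝ C) (hCo : IsOpen C)
    (hCf : ∀ z ∈ C, z ∉ frontier D.carrier) :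
    C ⊆ D.carrier ∨ C ⊆ (closure D.carrier)ᶜ := by
  by_contra h
  rw [not_or] at h
  obtain ⟨a, haC, haD⟩ := not_subset.1 h.1
  obtain ⟨b, hbC, hbE⟩ := not_subset.1 h.2
  have hbcl : b ∈ closure D.carrier := not_notMem.1 hbE
  -- `C` is a neighbourhood of `b ∈ closure D`, so it meets `D`
  obtain ⟨d, hdC, hdD⟩ : (C ∩ D.carrier).Nonempty :=
    mem_closure_iff_nhds.1 hbcl C (hCo.mem_nhds hbC)
  obtain ⟨z, hzC, hzf⟩ :=
    D.inter_frontier_nonempty_of_isPreconnected hC.isPreconnected ⟨d, hdC, hdD⟩ ⟨a, haC, haD⟩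
  exact hCf z hzC hzf

/-- Near a frontier point there are exterior points off any given cross: if `ζ ∈ frontier D` and
`N` is a neighbourhood of `ζ`, then `N` contains a point of `(closure D)ᶜ` with `re ≠ c₁` and
`im ≠ c₂`. (The exterior is open and accumulates at `ζ` by the Jordan curve theorem.) [folklore] -/
theorem exists_exterior_off_cross {ζ : ℂ} (hζ : ζ ∈ frontier D.carrier) {N : Set ℂ}
    (hN : N ∈ 𝓝 ζ) (c₁ c₂ : ℝ) :
    ∃ e ∈ N, e ∉ closure D.carrier ∧ e.re ≠ c₁ ∧ e.im ≠ c₂ := by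
  have hζE : ζ ∈ closure (closure D.carrier)ᶜ :=
    D.frontier_subset_closure_exterior Literature.Topology.PlaneTopology.JordanCurveTheorem_holds hζ
  obtain ⟨e₀, he₀N, he₀E⟩ : (interior N ∩ (closure D.carrier)ᶜ).Nonempty :=
    mem_closure_iff_nhds.1 hζE _ (interior_mem_nhds.2 hN)
  have hopen : IsOpen (interior N ∩ (closure D.carrier)ᶜ) :=
    isOpen_interior.inter isClosed_closure.isOpen_compl
  obtain ⟨ρ, hρ, hball⟩ := Metric.isOpen_iff.1 hopen e₀ ⟨he₀N, he₀E⟩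
  -- move off the two lines inside `ball e₀ ρ`
  obtain ⟨t₁, ht₁, ht₁'⟩ : ∃ t₁ : ℝ, |t₁| = ρ / 3 ∧ e₀.re + t₁ ≠ c₁ := by
    by_cases h : e₀.re + ρ / 3 = c₁
    · exact ⟨-(ρ / 3), by rw [abs_neg, abs_of_pos (by positivity)], by intro h'; linarith⟩
    · exact ⟨ρ / 3, abs_of_pos (by positivity), h⟩
  obtain ⟨t₂, ht₂, ht₂'⟩ : ∃ t₂ : ℝ, |t₂| = ρ / 3 ∧ e₀.im + t₂ ≠ c₂ := by
    by_cases h : e₀.im + ρ / 3 = c₂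
    · exact ⟨-(ρ / 3), by rw [abs_neg, abs_of_pos (by positivity)], by intro h'; linarith⟩
    · exact ⟨ρ / 3, abs_of_pos (by positivity), h⟩
  set e : ℂ := e₀ + (t₁ + t₂ * I) with he
  have hre : e.re = e₀.re + t₁ := by simp [he]
  have him : e.im = e₀.im + t₂ := by simp [he]
  have hdist : dist e e₀ < ρ := by
    rw [dist_eq, he, add_sub_cancel_left]
    have h1 : ‖(t₁ : ℂ) + t₂ * I‖ ≤ ‖(t₁ : ℂ)‖ + ‖(t₂ : ℂ) * I‖ := norm_add_le _ _
    rw [norm_mul, norm_I, mul_one, norm_real, norm_real, Real.norm_eq_abs, Real.norm_eq_abs,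
      ht₁, ht₂] at h1
    linarith
  have hmem := hball (mem_ball.2 hdist)
  exact ⟨e, interior_subset hmem.1, hmem.2, hre ▸ ht₁', him ▸ ht₂'⟩

/-- Near a frontier point there are points of the domain off any given cross. [folklore] -/
theorem exists_carrier_off_cross {ζ : ℂ} (hζ : ζ ∈ frontier D.carrier) {N : Set ℂ}
    (hN : N ∈ 𝓝 ζ) (c₁ c₂ : ℝ) :
    ∃ d ∈ N, d ∈ D.carrier ∧ d.re ≠ c₁ ∧ d.im ≠ c₂ := by
  have hζD : ζ ∈ closure D.carrier := frontier_subset_closure hζ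
  obtain ⟨d₀, hd₀N, hd₀D⟩ : (interior N ∩ D.carrier).Nonempty :=
    mem_closure_iff_nhds.1 hζD _ (interior_mem_nhds.2 hN)
  have hopen : IsOpen (interior N ∩ D.carrier) := isOpen_interior.inter D.isOpen
  obtain ⟨ρ, hρ, hball⟩ := Metric.isOpen_iff.1 hopen d₀ ⟨hd₀N, hd₀D⟩
  obtain ⟨t₁, ht₁, ht₁'⟩ : ∃ t₁ : ℝ, |t₁| = ρ / 3 ∧ d₀.re + t₁ ≠ c₁ := by
    by_cases h : d₀.re + ρ / 3 = c₁
    · exact ⟨-(ρ / 3), by rw [abs_neg, abs_of_pos (by positivity)], by intro h'; linarith⟩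
    · exact ⟨ρ / 3, abs_of_pos (by positivity), h⟩
  obtain ⟨t₂, ht₂, ht₂'⟩ : ∃ t₂ : ℝ, |t₂| = ρ / 3 ∧ d₀.im + t₂ ≠ c₂ := by
    by_cases h : d₀.im + ρ / 3 = c₂
    · exact ⟨-(ρ / 3), by rw [abs_neg, abs_of_pos (by positivity)], by intro h'; linarith⟩
    · exact ⟨ρ / 3, abs_of_pos (by positivity), h⟩
  set d : ℂ := d₀ + (t₁ + t₂ * I) with hd
  have hre : d.re = d₀.re + t₁ := by simp [hd]
  have him : d.im = d₀.im + t₂ := by simp [hd]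
  have hdist : dist d d₀ < ρ := by
    rw [dist_eq, hd, add_sub_cancel_left]
    have h1 : ‖(t₁ : ℂ) + t₂ * I‖ ≤ ‖(t₁ : ℂ)‖ + ‖(t₂ : ℂ) * I‖ := norm_add_le _ _
    rw [norm_mul, norm_I, mul_one, norm_real, norm_real, Real.norm_eq_abs, Real.norm_eq_abs,
      ht₁, ht₂] at h1
    linarith
  have hmem := hball (mem_ball.2 hdist)
  exact ⟨d, interior_subset hmem.1, hmem.2, hre ▸ ht₁', him ▸ ht₂'⟩

/-! ### Rectilinear boundary: the frontier is locally a cross -/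

/-- **Rectilinear frontier, locally.** If the boundary curve of `D` is covered by finitely many
axis-parallel segments, then every point `ζ` (of the frontier, in practice) has a neighbourhood in
which the frontier lies on the cross `{re = re ζ} ∪ {im = im ζ}` (segments not through `ζ` are
closed and stay away; a segment through `ζ` is part of the cross). [folklore] -/
theorem exists_pos_frontier_near_subset_cross
    (hrect : ∃ S : Finset (ℂ × ℂ), (∀ q ∈ S, q.1.re = q.2.re ∨ q.1.im = q.2.im) ∧
      frontier D.carrier ⊆ ⋃ q ∈ S, segment ℝ q.1 q.2) (ζ : ℂ) :
    ∃ r > 0, ∀ z ∈ frontier D.carrier, dist z ζ < r → z.re = ζ.re ∨ z.im = ζ.im := by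
  obtain ⟨S, hS, hcover⟩ := hrect
  -- eventually near `ζ`, every covering segment that is met passes through `ζ`
  have hev : ∀ᶠ z in 𝓝 ζ, ∀ q ∈ S, z ∈ segment ℝ q.1 q.2 → ζ ∈ segment ℝ q.1 q.2 := by
    refine (S.eventually_all).2 fun q _ => ?_
    by_cases hq : ζ ∈ segment ℝ q.1 q.2
    · exact Eventually.of_forall fun _ _ => hq
    · have hcl : IsClosed (segment ℝ q.1 q.2) := by
        have : IsCompact (segment ℝ q.1 q.2) := by
          rw [segment_eq_image_lineMap]; exact isCompact_Icc.image AffineMap.lineMap_continuous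
        exact this.isClosed
      filter_upwards [hcl.isOpen_compl.mem_nhds hq] with z hz hz'
      exact absurd hz' hz
  obtain ⟨r, hr, hball⟩ := Metric.eventually_nhds_iff.1 hev
  refine ⟨r, hr, fun z hz hzr => ?_⟩
  obtain ⟨q, hqS, hzq⟩ : ∃ q ∈ S, z ∈ segment ℝ q.1 q.2 := by
    simpa only [mem_iUnion, exists_prop] using hcover hz
  have hζq := hball hzr q hqS hzq
  rcases hS q hqS with h | h
  · -- vertical segment: constant real part
    left
    have hconv : Convex ℝ {w : ℂ | w.re = q.1.re} := by
      have : {w : ℂ | w.re = q.1.re} = reCLM ⁻¹' {q.1.re} := by ext w; simp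
      rw [this]; exact (convex_singleton _).linear_preimage reCLM.toLinearMap
    have hsub : segment ℝ q.1 q.2 ⊆ {w : ℂ | w.re = q.1.re} :=
      hconv.segment_subset rfl h.symm
    exact (hsub hzq).trans (hsub hζq).symm
  · right
    have hconv : Convex ℝ {w : ℂ | w.im = q.1.im} := by
      have : {w : ℂ | w.im = q.1.im} = imCLM ⁻¹' {q.1.im} := by ext w; simp
      rw [this]; exact (convex_singleton _).linear_preimage imCLM.toLinearMap
    have hsub : segment ℝ q.1 q.2 ⊆ {w : ℂ | w.im = q.1.im} :=
      hconv.segment_subset rfl h.symm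
    exact (hsub hzq).trans (hsub hζq).symm

/-! ### Open quadrants at a frontier point -/

/-- The open axis-parallel quadrant of the disc `B(ζ, r)` with signs `s₁, s₂ ∈ {1, -1}` is convex.
[folklore] -/
theorem convex_quadrant (ζ : ℂ) (s₁ s₂ r : ℝ) :
    Convex ℝ {z : ℂ | s₁ * ζ.re < s₁ * z.re ∧ s₂ * ζ.im < s₂ * z.im ∧ dist z ζ < r} := by
  have h1 : Convex ℝ {z : ℂ | s₁ * ζ.re < s₁ * z.re} :=
    convex_halfSpace_gt ⟨fun a b => by simp [mul_add], fun c a => by simp; ring⟩ _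
  have h2 : Convex ℝ {z : ℂ | s₂ * ζ.im < s₂ * z.im} :=
    convex_halfSpace_gt ⟨fun a b => by simp [mul_add], fun c a => by simp; ring⟩ _
  have h3 : Convex ℝ (ball ζ r) := convex_ball ζ r
  have : {z : ℂ | s₁ * ζ.re < s₁ * z.re ∧ s₂ * ζ.im < s₂ * z.im ∧ dist z ζ < r} =
      {z : ℂ | s₁ * ζ.re < s₁ * z.re} ∩ ({z : ℂ | s₂ * ζ.im < s₂ * z.im} ∩ ball ζ r) := by
    ext z; simp [mem_ball]
  rw [this]
  exact h1.inter (h2.inter h3)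

/-- The open quadrant is open. [folklore] -/
theorem isOpen_quadrant (ζ : ℂ) (s₁ s₂ r : ℝ) :
    IsOpen {z : ℂ | s₁ * ζ.re < s₁ * z.re ∧ s₂ * ζ.im < s₂ * z.im ∧ dist z ζ < r} := by
  have : {z : ℂ | s₁ * ζ.re < s₁ * z.re ∧ s₂ * ζ.im < s₂ * z.im ∧ dist z ζ < r} =
      {z : ℂ | s₁ * ζ.re < s₁ * z.re} ∩ ({z : ℂ | s₂ * ζ.im < s₂ * z.im} ∩ ball ζ r) := by
    ext z; simp [mem_ball]
  rw [this]
  refine (isOpen_lt continuous_const (continuous_const.mul continuous_re)).inter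
    ((isOpen_lt continuous_const (continuous_const.mul continuous_im)).inter isOpen_ball)

/-- **Quadrant dichotomy.** If near `ζ` the frontier of `D` lies on the cross through `ζ`, each
open quadrant of `B(ζ, r)` (any real weights `s₁, s₂`, in practice signs `±1`) lies in `D` or in
the exterior. [folklore] -/
theorem quadrant_subset_or_subset {ζ : ℂ} {r : ℝ}
    (hr : ∀ z ∈ frontier D.carrier, dist z ζ < r → z.re = ζ.re ∨ z.im = ζ.im) (s₁ s₂ : ℝ) :
    {z : ℂ | s₁ * ζ.re < s₁ * z.re ∧ s₂ * ζ.im < s₂ * z.im ∧ dist z ζ < r} ⊆ D.carrier ∨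
    {z : ℂ | s₁ * ζ.re < s₁ * z.re ∧ s₂ * ζ.im < s₂ * z.im ∧ dist z ζ < r} ⊆
      (closure D.carrier)ᶜ := by
  refine D.subset_or_subset_exterior_of_convex (convex_quadrant ζ s₁ s₂ r)
    (isOpen_quadrant ζ s₁ s₂ r) ?_
  rintro z ⟨h1, h2, h3⟩ hz
  rcases hr z hz h3 with h | h
  · rw [h] at h1; exact lt_irrefl _ h1
  · rw [h] at h2; exact lt_irrefl _ h2

/-- The sign of a nonzero real as `±1`, with `s * t > 0`. [folklore] -/
theorem exists_sign_mul_pos {t : ℝ} (ht : t ≠ 0) : ∃ s : ℝ, (s = 1 ∨ s = -1) ∧ 0 < s * t := by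
  rcases lt_or_gt_of_ne ht with h | h
  · exact ⟨-1, Or.inr rfl, by linarith⟩
  · exact ⟨1, Or.inl rfl, by linarith⟩

/-- **An exterior quadrant at every frontier point.** If near `ζ ∈ frontier D` the frontier lies
on the cross through `ζ` (radius `r > 0`), then one of the four open quadrants of `B(ζ, r)` lies in
the exterior `(closure D)ᶜ`. [folklore] -/
theorem exists_quadrant_subset_exterior {ζ : ℂ} (hζ : ζ ∈ frontier D.carrier) {r : ℝ}
    (hr0 : 0 < r) (hr : ∀ z ∈ frontier D.carrier, dist z ζ < r → z.re = ζ.re ∨ z.im = ζ.im) :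
    ∃ s₁ s₂ : ℝ, (s₁ = 1 ∨ s₁ = -1) ∧ (s₂ = 1 ∨ s₂ = -1) ∧
      {z : ℂ | s₁ * ζ.re < s₁ * z.re ∧ s₂ * ζ.im < s₂ * z.im ∧ dist z ζ < r} ⊆
        (closure D.carrier)ᶜ := by
  obtain ⟨e, heN, heE, hre, him⟩ :=
    D.exists_exterior_off_cross hζ (ball_mem_nhds ζ hr0) ζ.re ζ.im
  obtain ⟨s₁, hs₁, hs₁e⟩ := exists_sign_mul_pos (sub_ne_zero.2 hre)
  obtain ⟨s₂, hs₂, hs₂e⟩ := exists_sign_mul_pos (sub_ne_zero.2 him)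
  refine ⟨s₁, s₂, hs₁, hs₂, ?_⟩
  have heQ : e ∈ {z : ℂ | s₁ * ζ.re < s₁ * z.re ∧ s₂ * ζ.im < s₂ * z.im ∧ dist z ζ < r} :=
    ⟨by linarith [mul_sub s₁ e.re ζ.re], by linarith [mul_sub s₂ e.im ζ.im], mem_ball.1 heN⟩
  rcases D.quadrant_subset_or_subset hr s₁ s₂ with h | h
  · exact absurd (subset_closure (h heQ)) heE
  · exact h

/-- **Exterior quadrants near a frontier point, uniformly.** In the situation of
`exists_quadrant_subset_exterior`, every frontier point `ζ'` with `dist ζ' ζ < r/2` also has an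
open quadrant of radius `r/2` in the exterior (if `ζ' ≠ ζ` it lies on one arm of the cross, and one
of the two quadrants of `B(ζ, r)` adjacent to that arm is exterior). [folklore] -/
theorem exists_quadrant_subset_exterior_of_near {ζ : ℂ} (hζ : ζ ∈ frontier D.carrier) {r : ℝ}
    (hr0 : 0 < r) (hr : ∀ z ∈ frontier D.carrier, dist z ζ < r → z.re = ζ.re ∨ z.im = ζ.im)
    {ζ' : ℂ} (hζ' : ζ' ∈ frontier D.carrier) (hd : dist ζ' ζ < r / 2) :
    ∃ s₁ s₂ : ℝ, (s₁ = 1 ∨ s₁ = -1) ∧ (s₂ = 1 ∨ s₂ = -1) ∧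
      {z : ℂ | s₁ * ζ'.re < s₁ * z.re ∧ s₂ * ζ'.im < s₂ * z.im ∧ dist z ζ' < r / 2} ⊆
        (closure D.carrier)ᶜ := by
  -- a quadrant of `B(ζ, r)` containing an exterior point is exterior
  have key : ∀ e : ℂ, e ∉ closure D.carrier → ∀ s₁ s₂ : ℝ, (s₁ = 1 ∨ s₁ = -1) → (s₂ = 1 ∨ s₂ = -1) →
      0 < s₁ * (e.re - ζ.re) → 0 < s₂ * (e.im - ζ.im) → dist e ζ < r →
      {z : ℂ | s₁ * ζ.re < s₁ * z.re ∧ s₂ * ζ.im < s₂ * z.im ∧ dist z ζ < r} ⊆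
        (closure D.carrier)ᶜ := by
    intro e heE s₁ s₂ hs₁ hs₂ h1 h2 h3
    have heQ : e ∈ {z : ℂ | s₁ * ζ.re < s₁ * z.re ∧ s₂ * ζ.im < s₂ * z.im ∧ dist z ζ < r} :=
      ⟨by linarith [mul_sub s₁ e.re ζ.re], by linarith [mul_sub s₂ e.im ζ.im], h3⟩
    rcases D.quadrant_subset_or_subset hr s₁ s₂ with h | h
    · exact absurd (subset_closure (h heQ)) heE
    · exact h
  -- containment of the small quadrant at `ζ'` in the big one at `ζ`
  have mono : ∀ s₁ s₂ : ℝ, 0 ≤ s₁ * (ζ'.re - ζ.re) → 0 ≤ s₂ * (ζ'.im - ζ.im) →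
      {z : ℂ | s₁ * ζ'.re < s₁ * z.re ∧ s₂ * ζ'.im < s₂ * z.im ∧ dist z ζ' < r / 2} ⊆
      {z : ℂ | s₁ * ζ.re < s₁ * z.re ∧ s₂ * ζ.im < s₂ * z.im ∧ dist z ζ < r} := by
    intro s₁ s₂ h1 h2 z ⟨hz1, hz2, hz3⟩
    refine ⟨by linarith [mul_sub s₁ ζ'.re ζ.re], by linarith [mul_sub s₂ ζ'.im ζ.im], ?_⟩
    linarith [dist_triangle z ζ' ζ]
  by_cases hre : ζ'.re = ζ.re
  · by_cases him : ζ'.im = ζ.im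
    · -- `ζ' = ζ`
      have hζζ : ζ' = ζ := Complex.ext hre him
      subst hζζ
      obtain ⟨s₁, s₂, hs₁, hs₂, h⟩ := D.exists_quadrant_subset_exterior hζ' hr0 hr
      exact ⟨s₁, s₂, hs₁, hs₂, (mono s₁ s₂ (by simp) (by simp)).trans h⟩
    · -- `ζ'` on the vertical arm
      obtain ⟨s₂, hs₂, hs₂'⟩ := exists_sign_mul_pos (sub_ne_zero.2 him)
      have hρ : 0 < min (r / 2) |ζ'.im - ζ.im| :=
        lt_min (by linarith) (abs_pos.2 (sub_ne_zero.2 him))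
      obtain ⟨e, heN, heE, here, -⟩ :=
        D.exists_exterior_off_cross hζ' (ball_mem_nhds ζ' hρ) ζ.re ζ.im
      have hed : dist e ζ' < min (r / 2) |ζ'.im - ζ.im| := mem_ball.1 heN
      obtain ⟨s₁, hs₁, hs₁'⟩ := exists_sign_mul_pos (sub_ne_zero.2 here)
      -- `e.im` is on the same side of `ζ.im` as `ζ'.im`
      have hside : 0 < s₂ * (e.im - ζ.im) := by
        have h1 : |e.im - ζ'.im| < |ζ'.im - ζ.im| := by
          refine lt_of_le_of_lt ?_ (lt_of_lt_of_le hed (min_le_right _ _))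
          simpa [dist_eq] using abs_im_le_norm (e - ζ')
        rcases hs₂ with rfl | rfl
        · rw [one_mul] at hs₂' ⊢
          rw [abs_of_pos hs₂'] at h1
          linarith [neg_abs_le (e.im - ζ'.im)]
        · have h2 : ζ'.im - ζ.im < 0 := by linarith
          rw [abs_of_neg h2] at h1
          linarith [le_abs_self (e.im - ζ'.im)]
      have hdist : dist e ζ < r := by
        have := lt_of_lt_of_le hed (min_le_left _ _)
        linarith [dist_triangle e ζ' ζ]
      refine ⟨s₁, s₂, hs₁, hs₂, (mono s₁ s₂ (by rw [hre, sub_self, mul_zero]) hs₂'.le).trans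
        (key e heE s₁ s₂ hs₁ hs₂ hs₁' hside hdist)⟩
  · -- `ζ'` on the horizontal arm
    have him : ζ'.im = ζ.im := (hr ζ' hζ' (by linarith)).resolve_left hre
    obtain ⟨s₁, hs₁, hs₁'⟩ := exists_sign_mul_pos (sub_ne_zero.2 hre)
    have hρ : 0 < min (r / 2) |ζ'.re - ζ.re| :=
      lt_min (by linarith) (abs_pos.2 (sub_ne_zero.2 hre))
    obtain ⟨e, heN, heE, -, heim⟩ :=
      D.exists_exterior_off_cross hζ' (ball_mem_nhds ζ' hρ) ζ.re ζ.im
    have hed : dist e ζ' < min (r / 2) |ζ'.re - ζ.re| := mem_ball.1 heN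
    obtain ⟨s₂, hs₂, hs₂'⟩ := exists_sign_mul_pos (sub_ne_zero.2 heim)
    have hside : 0 < s₁ * (e.re - ζ.re) := by
      have h1 : |e.re - ζ'.re| < |ζ'.re - ζ.re| := by
        refine lt_of_le_of_lt ?_ (lt_of_lt_of_le hed (min_le_right _ _))
        simpa [dist_eq] using abs_re_le_norm (e - ζ')
      rcases hs₁ with rfl | rfl
      · rw [one_mul] at hs₁' ⊢
        rw [abs_of_pos hs₁'] at h1
        linarith [neg_abs_le (e.re - ζ'.re)]
      · have h2 : ζ'.re - ζ.re < 0 := by linarith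
        rw [abs_of_neg h2] at h1
        linarith [le_abs_self (e.re - ζ'.re)]
    have hdist : dist e ζ < r := by
      have := lt_of_lt_of_le hed (min_le_left _ _)
      linarith [dist_triangle e ζ' ζ]
    refine ⟨s₁, s₂, hs₁, hs₂, (mono s₁ s₂ hs₁'.le (by rw [him, sub_self, mul_zero])).trans
      (key e heE s₁ s₂ hs₁ hs₂ hside hs₂' hdist)⟩

/-- **A uniform exterior quadrant** ("exterior cone condition") for a Jordan domain with
rectilinear frontier: there is `r > 0` such that at every point of the boundary curve one of the
four open axis-parallel quadrants of radius `r` lies in the exterior `(closure D)ᶜ`. (Pointwise by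
`exists_quadrant_subset_exterior_of_near`, then a finite subcover of the compact frontier.)
[folklore] -/
theorem exists_uniform_exterior_quadrant
    (hrect : ∃ S : Finset (ℂ × ℂ), (∀ q ∈ S, q.1.re = q.2.re ∨ q.1.im = q.2.im) ∧
      frontier D.carrier ⊆ ⋃ q ∈ S, segment ℝ q.1 q.2) :
    ∃ r > 0, ∀ ζ ∈ frontier D.carrier, ∃ s₁ s₂ : ℝ, (s₁ = 1 ∨ s₁ = -1) ∧ (s₂ = 1 ∨ s₂ = -1) ∧
      ∀ z : ℂ, s₁ * ζ.re < s₁ * z.re → s₂ * ζ.im < s₂ * z.im → dist z ζ < r →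
        z ∉ closure D.carrier := by
  -- pointwise radii
  choose r hr hcross using fun ζ : ℂ => D.exists_pos_frontier_near_subset_cross hrect ζ
  obtain ⟨t, htF, hcover⟩ := D.isCompact_frontier.elim_nhds_subcover (fun ζ => ball ζ (r ζ / 2))
    (fun ζ _ => ball_mem_nhds ζ (by linarith [hr ζ]))
  set s : Finset ℝ := insert 1 (t.image fun ζ => r ζ / 2) with hs
  have hsne : s.Nonempty := Finset.insert_nonempty _ _
  refine ⟨s.min' hsne, ?_, ?_⟩
  · refine (Finset.lt_min'_iff s hsne).2 fun y hy => ?_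
    rcases Finset.mem_insert.1 hy with rfl | hy
    · exact one_pos
    · obtain ⟨ζ, -, rfl⟩ := Finset.mem_image.1 hy
      linarith [hr ζ]
  · intro ζ' hζ'
    obtain ⟨ζ, hζt, hζ'ζ⟩ := mem_iUnion₂.1 (hcover hζ')
    have hζt' : ζ ∈ t := hζt
    have hζF : ζ ∈ frontier D.carrier := htF ζ hζt'
    obtain ⟨s₁, s₂, hs₁, hs₂, hQ⟩ := D.exists_quadrant_subset_exterior_of_near hζF (hr ζ)
      (hcross ζ) hζ' (mem_ball.1 hζ'ζ)
    have hmin : s.min' hsne ≤ r ζ / 2 :=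
      Finset.min'_le s _ (Finset.mem_insert_of_mem (Finset.mem_image_of_mem _ hζt'))
    refine ⟨s₁, s₂, hs₁, hs₂, fun z h1 h2 h3 => ?_⟩
    exact hQ ⟨h1, h2, lt_of_lt_of_le h3 hmin⟩

/-! ### A flat piece of the boundary: the half-disc structure -/

/-- Auxiliary form of `halfDisc_structure_of_flat`: if the open half-disc `{ℓ > ℓ x}` of `B(x, r)`
lies in `D` and the half-disc `{ℓ < ℓ x}` in the exterior, then in `B(x, r)` membership in
`closure D` (resp. `D`) is `ℓ x ≤ ℓ z` (resp. `ℓ x < ℓ z`). Here `ℓ` is a real linear form and `e`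
a unit vector with `ℓ e = 1`. [folklore] -/
theorem halfDisc_iff_of_subset {x : ℂ} {r : ℝ} (ℓ : ℂ →L[ℝ] ℝ) (e : ℂ) (he : ℓ e = 1)
    (hne : ‖e‖ = 1)
    (hplus : {z : ℂ | ℓ x < ℓ z ∧ dist z x < r} ⊆ D.carrier)
    (hminus : {z : ℂ | ℓ z < ℓ x ∧ dist z x < r} ⊆ (closure D.carrier)ᶜ) :
    (∀ z, dist z x < r → (z ∈ closure D.carrier ↔ ℓ x ≤ ℓ z)) ∧
      ∀ z, dist z x < r → (z ∈ D.carrier ↔ ℓ x < ℓ z) := by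
  have hshift : ∀ (z : ℂ) (t : ℝ), ℓ (z + t • e) = ℓ z + t := by
    intro z t; rw [map_add, map_smul, he, smul_eq_mul, mul_one]
  have hdshift : ∀ (z : ℂ) (t : ℝ), dist (z + t • e) z = |t| := by
    intro z t; rw [dist_eq, add_sub_cancel_left, norm_smul, hne, mul_one, Real.norm_eq_abs]
  refine ⟨fun z hz => ⟨fun hzc => ?_, fun hle => ?_⟩, fun z hz => ⟨fun hzD => ?_, fun hlt => ?_⟩⟩
  · by_contra hlt
    exact hminus ⟨lt_of_not_ge hlt, hz⟩ hzc
  · rcases hle.lt_or_eq with hlt | heq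
    · exact subset_closure (hplus ⟨hlt, hz⟩)
    · refine Metric.mem_closure_iff.2 fun ε hε => ?_
      set t : ℝ := min (ε / 2) ((r - dist z x) / 2) with ht
      have ht0 : 0 < t := lt_min (by linarith) (by linarith)
      refine ⟨z + t • e, hplus ⟨?_, ?_⟩, ?_⟩
      · rw [hshift, ← heq]; linarith
      · calc dist (z + t • e) x ≤ dist (z + t • e) z + dist z x := dist_triangle _ _ _
          _ = |t| + dist z x := by rw [hdshift]
          _ < r := by rw [abs_of_pos ht0]; linarith [min_le_right (ε / 2) ((r - dist z x) / 2)]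
      · rw [dist_comm, hdshift, abs_of_pos ht0]
        linarith [min_le_left (ε / 2) ((r - dist z x) / 2)]
  · by_contra hle
    rcases (le_of_not_gt hle).lt_or_eq with hlt | heq
    · exact hminus ⟨hlt, hz⟩ (subset_closure hzD)
    · -- `ℓ z = ℓ x`: points `z - t e` of the exterior accumulate at `z ∈ D`, `D` open
      obtain ⟨ρ, hρ, hball⟩ := Metric.isOpen_iff.1 D.isOpen z hzD
      set t : ℝ := min (ρ / 2) ((r - dist z x) / 2) with ht
      have ht0 : 0 < t := lt_min (by linarith) (by linarith)
      have hmem : z + (-t) • e ∈ ball z ρ := by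
        rw [mem_ball, hdshift, abs_neg, abs_of_pos ht0]
        linarith [min_le_left (ρ / 2) ((r - dist z x) / 2)]
      refine hminus ⟨?_, ?_⟩ (subset_closure (hball hmem))
      · rw [hshift, heq]; linarith
      · calc dist (z + (-t) • e) x ≤ dist (z + (-t) • e) z + dist z x := dist_triangle _ _ _
          _ = |-t| + dist z x := by rw [hdshift]
          _ < r := by
            rw [abs_neg, abs_of_pos ht0]; linarith [min_le_right (ρ / 2) ((r - dist z x) / 2)]
  · exact hplus ⟨hlt, hz⟩

/-- **Half-disc structure at a flat boundary point.** Let `ℓ` be a real linear form on `ℂ` with a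
unit vector `e`, `ℓ e = 1` (`ℓ = im, e = i` or `ℓ = re, e = 1`). If `x ∈ frontier D` and the
frontier points of `B(x, r)` all satisfy `ℓ z = ℓ x`, then either `closure D ∩ B(x,r)` is the
closed half-disc `{ℓ ≥ ℓ x}` and `D ∩ B(x,r)` the open half-disc `{ℓ > ℓ x}`, or the same with the
opposite half-discs. (Each open half-disc is convex and misses the frontier, so lies in `D` or in
the exterior; both alternatives occur since `D` and the exterior accumulate at `x`.) [folklore] -/
theorem halfDisc_structure_of_flat {x : ℂ} (hx : x ∈ frontier D.carrier) {r : ℝ} (hr : 0 < r)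
    (ℓ : ℂ →L[ℝ] ℝ) (e : ℂ) (he : ℓ e = 1) (hne : ‖e‖ = 1)
    (hflat : ∀ z ∈ frontier D.carrier, dist z x < r → ℓ z = ℓ x) :
    ((∀ z, dist z x < r → (z ∈ closure D.carrier ↔ ℓ x ≤ ℓ z)) ∧
      ∀ z, dist z x < r → (z ∈ D.carrier ↔ ℓ x < ℓ z)) ∨
    ((∀ z, dist z x < r → (z ∈ closure D.carrier ↔ ℓ z ≤ ℓ x)) ∧
      ∀ z, dist z x < r → (z ∈ D.carrier ↔ ℓ z < ℓ x)) := by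
  have hlin : IsLinearMap ℝ (fun z : ℂ => ℓ z) := ⟨fun a b => map_add ℓ a b, fun c a => map_smul ℓ c a⟩
  -- the two open half-discs and the dichotomy for each
  have hdich : ∀ (m : ℂ →L[ℝ] ℝ), (∀ z ∈ frontier D.carrier, dist z x < r → m z = m x) →
      ({z : ℂ | m x < m z ∧ dist z x < r} ⊆ D.carrier ∨
        {z : ℂ | m x < m z ∧ dist z x < r} ⊆ (closure D.carrier)ᶜ) := by
    intro m hm
    have hml : IsLinearMap ℝ (fun z : ℂ => m z) := ⟨fun a b => map_add m a b, fun c a => map_smul m c a⟩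
    have hset : {z : ℂ | m x < m z ∧ dist z x < r} = {z : ℂ | m x < m z} ∩ ball x r := by
      ext z; simp [mem_ball]
    refine D.subset_or_subset_exterior_of_convex ?_ ?_ ?_
    · rw [hset]; exact (convex_halfSpace_gt hml _).inter (convex_ball x r)
    · rw [hset]; exact (isOpen_lt continuous_const m.continuous).inter isOpen_ball
    · rintro z ⟨h1, h2⟩ hz
      rw [hm z hz h2] at h1
      exact lt_irrefl _ h1
  have hflat' : ∀ z ∈ frontier D.carrier, dist z x < r → (-ℓ) z = (-ℓ) x := by
    intro z hz hzr; simp [hflat z hz hzr]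
  have hplus := hdich ℓ hflat
  have hminus := hdich (-ℓ) hflat'
  have hnegset : {z : ℂ | (-ℓ) x < (-ℓ) z ∧ dist z x < r} = {z : ℂ | ℓ z < ℓ x ∧ dist z x < r} := by
    ext z; simp
  rw [hnegset] at hminus
  -- an exterior point and a point of `D` off the line, inside the disc
  obtain ⟨e', he'N, he'E, he'ℓ⟩ : ∃ e' ∈ ball x r, e' ∉ closure D.carrier ∧ ℓ e' ≠ ℓ x := by
    have hxE : x ∈ closure (closure D.carrier)ᶜ :=
      D.frontier_subset_closure_exterior Literature.Topology.PlaneTopology.JordanCurveTheorem_holds hx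
    obtain ⟨e₀, he₀b, he₀E⟩ : (ball x r ∩ (closure D.carrier)ᶜ).Nonempty :=
      mem_closure_iff_nhds.1 hxE _ (ball_mem_nhds x hr)
    obtain ⟨ρ, hρ, hball⟩ := Metric.isOpen_iff.1 (isOpen_ball.inter isClosed_closure.isOpen_compl)
      e₀ ⟨he₀b, he₀E⟩
    by_cases h0 : ℓ e₀ = ℓ x
    · have hmem : e₀ + (ρ / 2) • e ∈ ball e₀ ρ := by
        rw [mem_ball, dist_eq, add_sub_cancel_left, norm_smul, hne, mul_one, Real.norm_eq_abs,
          abs_of_pos (by positivity)]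
        linarith
      refine ⟨e₀ + (ρ / 2) • e, (hball hmem).1, (hball hmem).2, ?_⟩
      rw [map_add, map_smul, he, h0, smul_eq_mul, mul_one]
      linarith
    · exact ⟨e₀, he₀b, he₀E, h0⟩
  obtain ⟨d', hd'N, hd'D, hd'ℓ⟩ : ∃ d' ∈ ball x r, d' ∈ D.carrier ∧ ℓ d' ≠ ℓ x := by
    have hxD : x ∈ closure D.carrier := frontier_subset_closure hx
    obtain ⟨d₀, hd₀b, hd₀D⟩ : (ball x r ∩ D.carrier).Nonempty :=
      mem_closure_iff_nhds.1 hxD _ (ball_mem_nhds x hr)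
    obtain ⟨ρ, hρ, hball⟩ := Metric.isOpen_iff.1 (isOpen_ball.inter D.isOpen) d₀ ⟨hd₀b, hd₀D⟩
    by_cases h0 : ℓ d₀ = ℓ x
    · have hmem : d₀ + (ρ / 2) • e ∈ ball d₀ ρ := by
        rw [mem_ball, dist_eq, add_sub_cancel_left, norm_smul, hne, mul_one, Real.norm_eq_abs,
          abs_of_pos (by positivity)]
        linarith
      refine ⟨d₀ + (ρ / 2) • e, (hball hmem).1, (hball hmem).2, ?_⟩
      rw [map_add, map_smul, he, h0, smul_eq_mul, mul_one]
      linarith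
    · exact ⟨d₀, hd₀b, hd₀D, h0⟩
  have he'r : dist e' x < r := mem_ball.1 he'N
  have hd'r : dist d' x < r := mem_ball.1 hd'N
  -- case analysis on the side of `d'`
  rcases lt_or_gt_of_ne hd'ℓ with hd'lt | hd'gt
  · -- `D` below: the right disjunct, via the auxiliary lemma for `-ℓ`, `-e`
    right
    have hM : {z : ℂ | ℓ z < ℓ x ∧ dist z x < r} ⊆ D.carrier := by
      rcases hminus with h | h
      · exact h
      · exact absurd (subset_closure hd'D) (h ⟨hd'lt, hd'r⟩)
    have hP : {z : ℂ | ℓ x < ℓ z ∧ dist z x < r} ⊆ (closure D.carrier)ᶜ := by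
      rcases hplus with h | h
      · -- then `e'` must be below, inside `D`: contradiction
        rcases lt_or_gt_of_ne he'ℓ with hlt | hgt
        · exact absurd (subset_closure (hM ⟨hlt, he'r⟩)) he'E
        · exact absurd (subset_closure (h ⟨hgt, he'r⟩)) he'E
      · exact h
    have key := D.halfDisc_iff_of_subset (-ℓ) (-e) (by simp [he]) (by rw [norm_neg, hne])
      (by simpa using hM) (by simpa using hP)
    simpa using key
  · left
    have hP : {z : ℂ | ℓ x < ℓ z ∧ dist z x < r} ⊆ D.carrier := by
      rcases hplus with h | h
      · exact h
      · exact absurd (subset_closure hd'D) (h ⟨hd'gt, hd'r⟩)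
    have hM : {z : ℂ | ℓ z < ℓ x ∧ dist z x < r} ⊆ (closure D.carrier)ᶜ := by
      rcases hminus with h | h
      · rcases lt_or_gt_of_ne he'ℓ with hlt | hgt
        · exact absurd (subset_closure (h ⟨hlt, he'r⟩)) he'E
        · exact absurd (subset_closure (hP ⟨hgt, he'r⟩)) he'E
      · exact h
    exact D.halfDisc_iff_of_subset ℓ e he hne hP hM

/-- **Flat horizontal edge.** If near `x ∈ frontier D` all frontier points have `im z = im x`,
then in `B(x, r)` either `closure D = {im ≥ im x}` and `D = {im > im x}` (the domain lies above the
edge) or `closure D = {im ≤ im x}` and `D = {im < im x}` (below). This is the local picture at a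
point of a flat horizontal boundary edge in Kenyon's Corollary 19. [cite: Kenyon2000, §5.3] -/
theorem halfDisc_structure_of_flat_im {x : ℂ} (hx : x ∈ frontier D.carrier) {r : ℝ} (hr : 0 < r)
    (hflat : ∀ z ∈ frontier D.carrier, dist z x < r → z.im = x.im) :
    ((∀ z, dist z x < r → (z ∈ closure D.carrier ↔ x.im ≤ z.im)) ∧
      ∀ z, dist z x < r → (z ∈ D.carrier ↔ x.im < z.im)) ∨
    ((∀ z, dist z x < r → (z ∈ closure D.carrier ↔ z.im ≤ x.im)) ∧
      ∀ z, dist z x < r → (z ∈ D.carrier ↔ z.im < x.im)) := by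
  simpa using D.halfDisc_structure_of_flat hx hr imCLM I (by simp) (by simp)
    (fun z hz hzr => by simpa using hflat z hz hzr)

/-- **Flat vertical edge.** The same with `re` in place of `im` (the domain lies to the right or
to the left of the edge). [cite: Kenyon2000, §5.3] -/
theorem halfDisc_structure_of_flat_re {x : ℂ} (hx : x ∈ frontier D.carrier) {r : ℝ} (hr : 0 < r)
    (hflat : ∀ z ∈ frontier D.carrier, dist z x < r → z.re = x.re) :
    ((∀ z, dist z x < r → (z ∈ closure D.carrier ↔ x.re ≤ z.re)) ∧
      ∀ z, dist z x < r → (z ∈ D.carrier ↔ x.re < z.re)) ∨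
    ((∀ z, dist z x < r → (z ∈ closure D.carrier ↔ z.re ≤ x.re)) ∧
      ∀ z, dist z x < r → (z ∈ D.carrier ↔ z.re < x.re)) := by
  simpa using D.halfDisc_structure_of_flat hx hr reCLM 1 (by simp) (by simp)
    (fun z hz hzr => by simpa using hflat z hz hzr)

end Literature.Probability.RandomPlanarGeometry.JordanDomain
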